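import Literature.Analysis.FluidPDE.KNSSLiouville
import Literature.Analysis.FluidPDE.SereginSverakBlowupSelection
import Literature.Analysis.FluidPDE.SwirlTransportProofs
import HarnessLib

/-!
# KNSS 2009, Theorem 5.3: the swirl Liouville argument, decomposed

Analysis/FluidPDE facts-and-glue file on the decomposition path of the named fact
`Literature.Analysis.FluidPDE.KNSS2009_liouville_bound_C_over_r` (Koch–Nadirashvili–Seregin–
Šverák, *Liouville theorems for the Navier–Stokes equations and applications*, Acta Math. 203
(2009) = arXiv:0709.3599, **Theorem 5.3**: a bounded weak solution of Navier–Stokes in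
`ℝ³ × (−∞, 0)` which is axisymmetric and satisfies `|u| ≤ C/√(x₁² + x₂²)` vanishes).

The printed proof (arXiv p. 10) has four inputs, each a theory of its own and none of them
proved in Mathlib or in the tree:

1. **§4 regularity** of bounded weak solutions ((4.6)–(4.8) with Lemma 3.1; equation numbers of
   §4 as in the companion `KNSSRegularity` — `KNSSRegularityWindow` records that the arXiv v1
   source numbers these displays (4.9)–(4.11)): `u = U + b(t)` with
   `U` smooth in `x`, all `∇ᵏU` bounded and Lipschitz in time, `b` bounded measurable. For the
   class `IsBoundedWeakNSSolutionOn (Iio 0)` this is already vendored as the accepted named fact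
   `Literature.Analysis.FluidPDE.KNSS2009_regularity_boundedWeak_ancient` (`KNSSRegularity`,
   written for the proof of Theorem 5.2: representative `U`, parasitic part `b : ℝ → ℝ³`,
   (4.7) for all `k`, the time-Lipschitz bounds (4.8) for `k ≥ 1` only, and the vorticity
   equation (4.5) in integrated form). The proof of Theorem 5.3 consumes §4 differently, and this
   file vendors that form as `Literature.Analysis.FluidPDE.KNSS2009_regularity_axisymmetric_swirl`;
   the **delta** to `KNSS2009_regularity_boundedWeak_ancient` is: (i) the time-Lipschitz bound
   (4.8) is asserted for `k = 0` as well (printed: (4.8) holds "for `k = 0, 1, 2, …`", p. 8; a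
   representative continuous across the windows exists because the parasitic part is determined
   up to a constant on each window, Remark 3.1 — see "Rendering choices"); (ii) for an
   axisymmetric `u` the representative `U` is taken axisymmetric and the parasitic part axial,
   `b = β(t) e_z`; (iii) instead of the vorticity equation (4.5) it records the swirl equation
   (5.10) = (5.7) = (1.8) for `f = r u_θ = x₀U₁ − x₁U₀`,
   `fₜ + u_r f_{,r} + u_z f_{,z} = Δf − (2/r) f_{,r}` ("We set `f = r u_θ` and recall that …",
   first lines of the proof of Theorem 5.3).
2. **Lemma 2.1** (p. 5), the stability of the strong maximum principle for
   `uₜ + a·∇u − Δu = 0` with bounded measurable drift on a bounded domain, with `δ` uniform in the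
   drift bound. Vendored **as printed** (bounded domain `Ω`, `Ω' ⊂⊂ Ω`, `K ⊂ Ω` compact, `τ > 0`)
   as `Literature.Analysis.FluidPDE.KNSS2009_lemma21`; the whole-space consequence used for
   Theorems 5.1–5.2 is the tree's `KNSS2009_lemma21_halfball` (`KNSSRegularity`). Theorem 5.3
   needs the bounded-domain form: the drift of (5.10), `u + (2/r) e_r`, is bounded only away
   from the axis, uniformly over the rescaled family thanks to `|u| ≤ C/r`.
3. **The scaling and cut-off argument** ((5.12)–(5.20), p. 10): if `M = sup f > 0`, rescaling
   `f → f^λ(x,t) = f(λx, λ²t)`, `u → λu(λx, λ²t)` (which preserves (5.10) and the bounds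
   `|f^λ| ≤ C`, `|u^λ| ≤ C/r`) moves a near-maximum point next to the axis, Lemma 2.1 makes
   `f^λ ≥ M − ε` on a long annular cylinder, and testing (5.10) against an axisymmetric cut-off
   `φ = ξ(r)η(z)ζ(t)` gives `|I| + |II| + |III| ≤ C(Lδ² + δT₁) + O(ε)` against
   `−∫(2/r) f^λ_{,r} φ = 4π∫ f^λ φ_{,r} dr dz dt ≤ −8πMLT₁ + CT₁ + CL + O(ε)` (the key point being
   that `f` vanishes on the axis), a contradiction; so `sup f ≤ 0`. This is a *linear* statement
   about a scalar `f` and a divergence-free drift `u` with `|u| ≤ C/r`, vendored as the named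
   fact `Literature.Analysis.FluidPDE.KNSS2009_swirl_sup_nonpos` (its proof needs item 2 and
   cylindrical integration by parts, nothing else).
4. **Theorem 5.2** (the swirl-free case), the tree's named fact
   `Literature.Analysis.FluidPDE.KNSS2009_liouville_axisymmetric_no_swirl` (`KNSSLiouville`).

This file vendors 1–3 and **proves the assembly**:

* `KNSS2009_swirl_sup_nonpos.eq_zero`: item 3 applied to `f` and `−f` gives `f ≡ 0`
  ("It follows in a similar way that `inf f ≥ 0` and therefore `f` must vanish");
* `KNSS2009_thm53_ae_swirl_free`: items 1 and 3 make an axisymmetric bounded weak solution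
  with `r‖u‖ ≤ C` swirl-free almost everywhere ("This means that the solution `u` is
  swirl-free"); the work is in transporting the a.e. hypotheses on the `L^∞` class to the smooth
  representative (joint continuity of `U`, `∇U`, `∇²U` from the time-Lipschitz bounds (4.8);
  a.e. bounds are everywhere bounds for continuous functions) and in the calculus of the swirl
  (`SwirlTransportProofs`: `DΓ h = ⟪Jx, DU h⟫ + ⟪Jh, U⟫`, `ΔΓ = ⟪Jx, ΔU⟫ + 2(∂₀U₁ − ∂₁U₀)`);
* `KNSS2009_liouville_bound_C_over_r_of_facts`: with item 4 and the tree's proved last line of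
  the proof (`KNSS2009_liouville_axisymmetric_no_swirl.ae_eq_zero_of_bound`), Theorem 5.3 as
  printed follows from the three named facts 1, 3, 4 (and 3 is where 2 enters).

## Rendering choices

* Lemma 2.1 is printed for weak solutions (`u, ∇ₓu ∈ L²_loc(Ω × (0,T))`, equation in
  distributions, [LSU] regularity). As in `KNSSRegularity` it is vendored for an explicit
  elementary subclass — `C²` slices on `Ω`, `∇u` and `Δu` jointly continuous on `(0, T] × Ω`,
  the equation in time-integrated form `u(t,x) − u(s,x) = ∫ₛᵗ (Δu − Du[a]) dτ` (such a `u` is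
  locally Lipschitz in `t` and solves the equation in distributions, by Fubini) — so that the
  fact is implied by the printed lemma and can be applied without parabolic Sobolev spaces.
  `sup |u| = M` is relaxed to `|u| ≤ M` (equivalent statement: apply the printed lemma with the
  true supremum `M' ∈ [M(1−δ), M]` and `ε/2`), and `δ = δ(Ω, Ω', K, T, ‖a‖_∞, τ, ε)` is rendered
  uniform over all drifts with `‖a‖_∞ ≤ A`, which is what the printed compactness proof gives and
  what §5 uses (families of rescaled solutions).
* In item 3 the drift bound `|u| ≤ C/r` ((5.13), an `L^∞` statement) is asked for a.e. `t` only,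
  and `|f| ≤ C`, `f = 0` on the axis, axisymmetry of `f` pointwise for the continuous
  representative; the equation (5.10) is asked off the axis (`r ≠ 0`, where its coefficient
  `2/r` is finite) in time-integrated form with the tree's `partialDeriv (eR x)` for `∂ᵣ`, exactly
  the shape of the accepted `Fluid.swirl_transport`.
* Item 1 renders (4.7)–(4.8), exactly as `KNSS2009_regularity_boundedWeak_ancient` does, by
  `iteratedFDeriv` bounds uniform on `(−∞, 0)` and time-Lipschitz bounds, here for every order
  `k ≥ 0` ((4.8) is printed for `k = 0, 1, 2, …`), for a representative chosen once and for all
  on `(−∞, 0)`: the parasitic part `b` of Lemma 3.1 is determined up to an additive constant on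
  each window (Remark 3.1), so the representatives of overlapping windows differ by
  `x`-independent constants and glue, by constant corrections, to a representative continuous in
  `t` with the bounds of order `k ≥ 1` and the time-Lipschitz bound of order `0` uniform; the
  uniform bound of order `0` is kept by absorbing into `b` a bounded Lipschitz `x`-independent
  function of `t` (the piecewise-affine interpolation of the accumulated constants), which
  changes none of the other clauses. The representative is then normalised to be axisymmetric
  (subtract its horizontal value on the axis), after which `b(t) = β(t) e_z` for a.e. `t`.

## References

* G. Koch, N. Nadirashvili, G. Seregin, V. Šverák, *Liouville theorems for the Navier–Stokes
  equations and applications*, Acta Math. 203 (2009) 83–105 = arXiv:0709.3599 (arXiv page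
  numbers): §2 Lemma 2.1 with proof (p. 5); §3 Lemma 3.1, Remark 3.1 (p. 7); §4 (4.6)–(4.8)
  (p. 8); §5 (5.3)–(5.7), (5.10) (p. 9), Theorem 5.3 with proof, (5.12)–(5.20) (p. 10); §1 (1.8).
  [KochNadirashviliSereginSverak2009]
* O. A. Ladyzhenskaya, V. A. Solonnikov, N. N. Ural'ceva, *Linear and quasilinear equations of
  parabolic type* (AMS 1968) — KNSS's reference [LSU] behind Lemma 2.1.
-/

noncomputable section

open MeasureTheory Set Function Filter Topology TopologicalSpace InnerProductSpace
open scoped Laplacian RealInnerProductSpace ContDiff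

namespace Literature.Analysis.FluidPDE

/-! ### Lemma 2.1 as printed: stability of the strong maximum principle on a bounded domain -/

section MaximumPrinciple

variable (E : Type*) [NormedAddCommGroup E] [InnerProductSpace ℝ E] [FiniteDimensional ℝ E]
  [MeasurableSpace E] [BorelSpace E]

/-- **KNSS 2009, Lemma 2.1 (stability of the strong maximum principle)** (Acta Math. 203 (2009)
= arXiv:0709.3599, §2, p. 5): "Let us consider equation `uₜ + a(x,t)∇u − Δu = 0` with bounded
measurable coefficient `a` in `Ω × (0,T)` [`Ω ⊂ ℝⁿ` a bounded domain]. Let `K` be a compact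
subset of `Ω`, `Ω' ⊂ Ω̄' ⊂ Ω` and `τ > 0`. Then for each `ε > 0` there exists `δ > 0`,
`δ = δ(Ω, Ω', K, T, ‖a‖_{L^∞}, τ, ε)` such that if `u` is a bounded solution with
`sup_{Ω×(0,T)} |u| = M` and `sup_{x ∈ K} u(x,T) ≥ M(1 − δ)`, then `u(x,t) ≥ M(1 − ε)` in
`Ω' × (τ, T)`." **Statement.** On a finite-dimensional real inner product space `E` (KNSS: `ℝⁿ`;
Theorem 5.2 uses `n = 5`), for `Ω` open, bounded and connected, `closure Ω' ⊆ Ω`, `K ⊆ Ω`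
compact, `τ > 0`, `ε > 0`, a drift bound `A` and a final time `T`, there is `δ > 0` such that:
for every jointly measurable drift `a` with `‖a‖ ≤ A` on `(0,T] × Ω` and every `u : ℝ → E → ℝ`
in the elementary solution class — `u(t, ·)` is `C²` on `Ω` for `t ∈ (0,T]`, `∇u` and `Δu` are
jointly continuous on `(0,T] × Ω`, and `u(t,x) − u(s,x) = ∫ₛᵗ (Δu(τ,·)(x) − Du(τ,·)(x)[a(τ,x)]) dτ`
for `x ∈ Ω`, `0 < s ≤ t ≤ T` (such a `u` has `u, ∇u ∈ L²_loc` and solves the equation in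
distributions, so it is a weak solution in the printed sense) — with `|u| ≤ M` on `(0,T] × Ω`,
`M > 0`, and `u(T, x) ≥ M(1 − δ)` for some `x ∈ K`, one has `u ≥ M(1 − ε)` on `Ω' × (τ, T)`.
(`|u| ≤ M` instead of `sup |u| = M` is an equivalent formulation — apply the printed lemma to the
true supremum `M' ∈ [M(1−δ), M]` with `ε/2` —, and the uniformity of `δ` in `‖a‖_∞ ≤ A` is what
the printed compactness proof yields and what the rescaled families of §5 require.) The
whole-space half-ball form used for Theorems 5.1–5.2 is `KNSS2009_lemma21_halfball`. [cite: KochNadirashviliSereginSverak2009, Lemma 2.1 (arXiv p. 5)] -/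
def KNSS2009_lemma21 : Prop :=
  ∀ ⦃Ω Ω' K : Set E⦄ ⦃T τ A ε : ℝ⦄,
    IsOpen Ω → Bornology.IsBounded Ω → IsConnected Ω → closure Ω' ⊆ Ω → IsCompact K → K ⊆ Ω →
    0 < τ → 0 < ε →
    ∃ δ > 0, ∀ ⦃a : ℝ → E → E⦄ ⦃u : ℝ → E → ℝ⦄ ⦃M : ℝ⦄,
      -- the drift: jointly measurable, bounded by `A` on `(0, T] × Ω`
      Measurable (uncurry a) → (∀ t ∈ Ioc 0 T, ∀ x ∈ Ω, ‖a t x‖ ≤ A) →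
      -- the solution class on `(0, T] × Ω`
      (∀ t ∈ Ioc 0 T, ContDiffOn ℝ 2 (u t) Ω) →
      ContinuousOn (fun p : ℝ × E => fderiv ℝ (u p.1) p.2) (Ioc 0 T ×ˢ Ω) →
      ContinuousOn (fun p : ℝ × E => (Δ (u p.1)) p.2) (Ioc 0 T ×ˢ Ω) →
      (∀ x ∈ Ω, ∀ s t : ℝ, 0 < s → s ≤ t → t ≤ T →
        u t x - u s x = ∫ r in s..t, ((Δ (u r)) x - fderiv ℝ (u r) x (a r x))) →
      -- `|u| ≤ M`, `M > 0`, and `u(T, ·) ≥ M (1 - δ)` somewhere on `K`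
      0 < M → (∀ t ∈ Ioc 0 T, ∀ x ∈ Ω, |u t x| ≤ M) → (∃ x ∈ K, M * (1 - δ) ≤ u T x) →
      ∀ t ∈ Ioo τ T, ∀ x ∈ Ω', M * (1 - ε) ≤ u t x

end MaximumPrinciple

section R3

/-- Local notation for physical space `ℝ³ = EuclideanSpace ℝ (Fin 3)`. -/
local notation "ℝ³" => EuclideanSpace ℝ (Fin 3)

/-! ### The core of the proof of Theorem 5.3: `sup f ≤ 0` for the swirl equation -/

/-- **KNSS 2009, proof of Theorem 5.3, the scaling and cut-off argument** (Acta Math. 203 (2009)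
= arXiv:0709.3599, p. 10, from "We set `f = r u_θ`" to "We have proved that `sup f ≤ 0`"):
the *linear* Liouville-type statement it establishes. Let `f : ℝ³ × (−∞,0) → ℝ` and a drift
`u : ℝ³ × (−∞,0) → ℝ³` satisfy: `f(t,·)` is smooth with `∇f`, `Δf` jointly continuous; `f` is
an axisymmetric scalar vanishing on the axis ("The key point then is that `f^λ` vanishes at the
`x₃`-axis") and bounded, `|f| ≤ C` ((5.12)); `u` is jointly measurable with smooth
divergence-free slices and `|u| ≤ C/r` ((5.13), for a.e. `t`); and the swirl equation (5.10),
`fₜ + u·∇f = Δf − (2/r) f_{,r}`, holds off the axis in time-integrated form. Then `f ≤ 0`.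
Printed proof: all hypotheses are invariant under `f → f(λx, λ²t)`, `u → λu(λx, λ²t)` and under
translations along the axis and in time; if `M = sup f > 0`, rescale a near-maximum point to
distance `δ + R/2` from the axis, apply Lemma 2.1 (`KNSS2009_lemma21`) on an annular cylinder
around it (where the drift `u + (2/r)e_r` is bounded by `C/δ`, uniformly in `λ`) to get
`f^λ ≥ M − ε` on `{δ ≤ r ≤ δ+R, |z − z̄| ≤ L} × (t̄ − T₁, t̄)` ((5.14)), test (5.10) against
`φ = ξ(r)η(z)ζ(t)` ((5.15)–(5.16)): `|I| ≤ CLδ² + O(ε)`, `|II| ≤ CδT₁ + O(ε)` ((5.18)) whereas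
`−∫(2/r)f^λ_{,r}φ = 4π∫f^λ φ_{,r} dr dz dt ≤ −8πMLT₁ + CT₁ + CL + O(ε)` ((5.19)–(5.20)),
impossible for `L, T₁` large. Applied to `−f` it gives `inf f ≥ 0`
(`KNSS2009_swirl_sup_nonpos.eq_zero`). [cite: KochNadirashviliSereginSverak2009, proof of Thm 5.3, (5.10)–(5.20) (arXiv p. 10)] -/
def KNSS2009_swirl_sup_nonpos : Prop :=
  ∀ ⦃f : ℝ → ℝ³ → ℝ⦄ ⦃u : ℝ → ℝ³ → ℝ³⦄,
    -- the scalar: smooth slices, `∇f` and `Δf` jointly continuous on `(−∞, 0) × ℝ³`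
    (∀ t < 0, ContDiff ℝ ∞ (f t)) →
    ContinuousOn (fun p : ℝ × ℝ³ => fderiv ℝ (f p.1) p.2) (Iio 0 ×ˢ univ) →
    ContinuousOn (fun p : ℝ × ℝ³ => (Δ (f p.1)) p.2) (Iio 0 ×ˢ univ) →
    -- axisymmetric, zero on the axis, bounded ((5.12))
    (∀ t < 0, IsAxisymmetricScalar (f t)) →
    (∀ t < 0, ∀ x, cylRadius x = 0 → f t x = 0) →
    (∃ C : ℝ, ∀ t < 0, ∀ x, |f t x| ≤ C) →
    -- the drift: jointly measurable, smooth divergence-free slices, `|u| ≤ C / r` ((5.13))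
    Measurable (uncurry u) →
    (∀ t < 0, ContDiff ℝ ∞ (u t)) → (∀ t < 0, VectorCalculus.IsDivFree (u t)) →
    (∃ C : ℝ, ∀ᵐ t ∂((volume : Measure ℝ).restrict (Iio 0)), ∀ x, cylRadius x * ‖u t x‖ ≤ C) →
    -- the swirl equation (5.10) off the axis, integrated in time
    (∀ x, cylRadius x ≠ 0 → ∀ s t : ℝ, s ≤ t → t < 0 →
      f t x - f s x = ∫ τ in s..t, ((Δ (f τ)) x - fderiv ℝ (f τ) x (u τ x) -
        2 / cylRadius x * partialDeriv (eR x) (f τ) x)) →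
    ∀ t < 0, ∀ x, f t x ≤ 0

/-! ### §4 and (5.10) for an axisymmetric bounded weak solution -/

/-- **KNSS 2009, §4 regularity and the swirl equation for an axisymmetric bounded weak
solution** (Acta Math. 203 (2009) = arXiv:0709.3599: §4 p. 8, (4.6)–(4.8) [numbering as in the
companion `KNSSRegularity`; (4.9)–(4.11) in the arXiv v1 source, see `KNSSRegularityWindow`] with
Lemma 3.1 and Remark 3.1, p. 7 — a bounded weak solution is `u = v + w + b(t)` with `|∇ᵏₓ u| ≤ C(k)` (4.7) and
`‖∇ᵏₓ ∂ₜ(u − b)‖_{L^∞} ≤ C(k)` (4.8), `k = 0, 1, 2, …`, uniformly on `ℝ³ × (−∞, 0)` for an ancient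
solution as asserted on p. 10; §5 p. 10, proof of Theorem 5.3, first lines: "We set `f = r u_θ`
and recall that `fₜ + u_r f_{,r} + u_z f_{,z} = Δf − (2/r) f_{,r}`" ((5.10) = (5.7) = (1.8))).
This is the form of §4 consumed by the proof of Theorem 5.3; §4 for the same class is already
the accepted named fact `KNSS2009_regularity_boundedWeak_ancient` (`KNSSRegularity`, the form
consumed by Theorem 5.2), and the **delta** is: the time-Lipschitz bound (4.8) also for `k = 0`
(printed for `k = 0, 1, 2, …`; a representative continuous across windows exists since `b` is
determined up to a constant per window, Remark 3.1, module docstring), the axisymmetric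
normalisation with axial parasitic part `β e_z`, and the swirl equation (5.10) in place of the
vorticity equation (4.5). **Statement.** Let `u` be a bounded weak solution of Navier–Stokes (`ν = 1`) in `ℝ³ × (−∞, 0)`
which is axisymmetric as an `L^∞` function (for every `θ`, `u(t, R_θ x) = R_θ u(t, x)` a.e. in
`x`, for a.e. `t`). Then there are a representative `U : ℝ → ℝ³ → ℝ³` and a bounded measurable
`β : ℝ → ℝ` with: `u(t, ·) = U(t, ·) + β(t) e_z` a.e., for a.e. `t < 0` (the parasitic part of
an axisymmetric solution can be taken axial once `U` is normalised to be axisymmetric: subtract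
from `U` its horizontal value on the axis); `U` jointly measurable; every slice `U(t, ·)`,
`t < 0`, smooth, divergence free and (pointwise) axisymmetric; (4.7) `‖∇ᵏU‖ ≤ C_k` on
`(−∞, 0) × ℝ³` and (4.8) `‖∇ᵏU(t, x) − ∇ᵏU(s, x)‖ ≤ L_k |t − s|` for all `k ≥ 0`; and the swirl
`Γ = swirl (U t) = x₀U₁ − x₁U₀ = r u_θ` satisfies (5.10) with drift `U + β e_z` off the axis, in
time-integrated form,
`Γ(t,x) − Γ(s,x) = ∫ₛᵗ (ΔΓ − DΓ[U + β e_z] − (2/r) ∂ᵣΓ)(τ, x) dτ` for `r(x) ≠ 0`, `s ≤ t < 0`.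
(For the derivation of (5.10) from the equations, pair the momentum equation with `J x = r e_θ`
as in the tree's `swirl_transport_holds`; the pressure of an axisymmetric solution is
axisymmetric and drops out, and `⟪J(β e_z), U⟫ = 0`.) None of §4 (Oseen-kernel estimates
(3.7)–(3.11), Lemma 3.1, Serrin's bootstrap (4.4)–(4.8)) is proved in Mathlib or the tree. [cite: KochNadirashviliSereginSverak2009, §4 (4.6)–(4.8) p. 8 and proof of Thm 5.3, (5.10) (arXiv p. 10)] -/
def KNSS2009_regularity_axisymmetric_swirl : Prop :=
  ∀ ⦃u : ℝ → ℝ³ → ℝ³⦄, IsBoundedWeakNSSolutionOn (Iio 0) isOpen_Iio 1 u →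
    (∀ θ : ℝ, ∀ᵐ t ∂((volume : Measure ℝ).restrict (Iio 0)),
      (fun x => u t (rotZ θ x)) =ᵐ[volume] fun x => rotZ θ (u t x)) →
    ∃ (U : ℝ → ℝ³ → ℝ³) (β : ℝ → ℝ),
      Measurable β ∧ (∃ C : ℝ, ∀ t, |β t| ≤ C) ∧ Measurable (uncurry U) ∧
      (∀ᵐ t ∂((volume : Measure ℝ).restrict (Iio 0)), u t =ᵐ[volume] fun x => U t x + β t • eZ) ∧
      (∀ t < 0, ContDiff ℝ ∞ (U t)) ∧
      (∀ t < 0, VectorCalculus.IsDivFree (U t)) ∧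
      (∀ t < 0, IsAxisymmetric (U t)) ∧
      (∀ k : ℕ, ∃ C : ℝ, ∀ t < 0, ∀ x, ‖iteratedFDeriv ℝ k (U t) x‖ ≤ C) ∧
      (∀ k : ℕ, ∃ L : ℝ, ∀ s < 0, ∀ t < 0, ∀ x,
        ‖iteratedFDeriv ℝ k (U t) x - iteratedFDeriv ℝ k (U s) x‖ ≤ L * |t - s|) ∧
      (∀ x, cylRadius x ≠ 0 → ∀ s t : ℝ, s ≤ t → t < 0 →
        swirl (U t) x - swirl (U s) x =
          ∫ τ in s..t, ((Δ (swirl (U τ))) x - fderiv ℝ (swirl (U τ)) x (U τ x + β τ • eZ) -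
            2 / cylRadius x * partialDeriv (eR x) (swirl (U τ)) x))

/-! ### `f ≡ 0`: the argument applied to `f` and to `−f` -/

/-- **"It follows in a similar way that `inf f ≥ 0` and therefore `f` must vanish"** (KNSS 2009,
proof of Theorem 5.3, arXiv p. 10): under `KNSS2009_swirl_sup_nonpos`, a scalar `f` in its
hypotheses vanishes identically, because `−f` satisfies the same (linear, homogeneous)
hypotheses with the same drift. [cite: KochNadirashviliSereginSverak2009, proof of Thm 5.3 (arXiv p. 10)] -/
theorem KNSS2009_swirl_sup_nonpos.eq_zero (hB : KNSS2009_swirl_sup_nonpos)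
    {f : ℝ → ℝ³ → ℝ} {u : ℝ → ℝ³ → ℝ³}
    (h1 : ∀ t < 0, ContDiff ℝ ∞ (f t))
    (h2 : ContinuousOn (fun p : ℝ × ℝ³ => fderiv ℝ (f p.1) p.2) (Iio 0 ×ˢ univ))
    (h3 : ContinuousOn (fun p : ℝ × ℝ³ => (Δ (f p.1)) p.2) (Iio 0 ×ˢ univ))
    (h4 : ∀ t < 0, IsAxisymmetricScalar (f t))
    (h5 : ∀ t < 0, ∀ x, cylRadius x = 0 → f t x = 0)
    (h6 : ∃ C : ℝ, ∀ t < 0, ∀ x, |f t x| ≤ C)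
    (h7 : Measurable (uncurry u))
    (h8 : ∀ t < 0, ContDiff ℝ ∞ (u t)) (h9 : ∀ t < 0, VectorCalculus.IsDivFree (u t))
    (h10 : ∃ C : ℝ, ∀ᵐ t ∂((volume : Measure ℝ).restrict (Iio 0)), ∀ x,
      cylRadius x * ‖u t x‖ ≤ C)
    (h11 : ∀ x, cylRadius x ≠ 0 → ∀ s t : ℝ, s ≤ t → t < 0 →
      f t x - f s x = ∫ τ in s..t, ((Δ (f τ)) x - fderiv ℝ (f τ) x (u τ x) -
        2 / cylRadius x * partialDeriv (eR x) (f τ) x)) :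
    ∀ t < 0, ∀ x, f t x = 0 := by
  have hle : ∀ t < 0, ∀ x, f t x ≤ 0 := hB h1 h2 h3 h4 h5 h6 h7 h8 h9 h10 h11
  -- the hypotheses for `-f`
  have hneg : ∀ t, (fun x => -f t x) = -(f t) := fun t => rfl
  have h1' : ∀ t < 0, ContDiff ℝ ∞ fun x => -f t x := fun t ht => (h1 t ht).neg
  have h2' : ContinuousOn (fun p : ℝ × ℝ³ => fderiv ℝ (fun x => -f p.1 x) p.2) (Iio 0 ×ˢ univ) := by
    have : (fun p : ℝ × ℝ³ => fderiv ℝ (fun x => -f p.1 x) p.2) =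
        fun p => -fderiv ℝ (f p.1) p.2 := funext fun p => fderiv_fun_neg
    rw [this]
    exact h2.neg
  have h3' : ContinuousOn (fun p : ℝ × ℝ³ => (Δ fun x => -f p.1 x) p.2) (Iio 0 ×ˢ univ) := by
    have : (fun p : ℝ × ℝ³ => (Δ fun x => -f p.1 x) p.2) = fun p => -(Δ (f p.1)) p.2 :=
      funext fun p => by rw [hneg, InnerProductSpace.laplacian_neg]; rfl
    rw [this]
    exact h3.neg
  have h4' : ∀ t < 0, IsAxisymmetricScalar fun x => -f t x := fun t ht θ x => by
    simp only [h4 t ht θ x]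
  have h5' : ∀ t < 0, ∀ x, cylRadius x = 0 → -f t x = 0 := fun t ht x hx => by
    rw [h5 t ht x hx, neg_zero]
  have h6' : ∃ C : ℝ, ∀ t < 0, ∀ x, |(-f t x)| ≤ C := by
    obtain ⟨C, hC⟩ := h6
    exact ⟨C, fun t ht x => by rw [abs_neg]; exact hC t ht x⟩
  have h11' : ∀ x, cylRadius x ≠ 0 → ∀ s t : ℝ, s ≤ t → t < 0 →
      (-f t x) - (-f s x) = ∫ τ in s..t, ((Δ fun y => -f τ y) x -
        fderiv ℝ (fun y => -f τ y) x (u τ x) -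
        2 / cylRadius x * partialDeriv (eR x) (fun y => -f τ y) x) := by
    intro x hx s t hst ht
    have hint : (fun τ => (Δ fun y => -f τ y) x - fderiv ℝ (fun y => -f τ y) x (u τ x) -
        2 / cylRadius x * partialDeriv (eR x) (fun y => -f τ y) x) =
        fun τ => -((Δ (f τ)) x - fderiv ℝ (f τ) x (u τ x) -
          2 / cylRadius x * partialDeriv (eR x) (f τ) x) := by
      funext τ
      rw [partialDeriv_apply, partialDeriv_apply, hneg, InnerProductSpace.laplacian_neg,
        fderiv_neg]
      simp only [Pi.neg_apply, neg_apply]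
      ring
    rw [hint, intervalIntegral.integral_neg, ← h11 x hx s t hst ht]
    ring
  have hge : ∀ t < 0, ∀ x, -f t x ≤ 0 := hB h1' h2' h3' h4' h5' h6' h7 h8 h9 h10 h11'
  intro t ht x
  have := hge t ht x
  have := hle t ht x
  linarith

/-! ### Joint continuity from time-Lipschitz bounds -/

section JointContinuity

variable {X Y : Type*} [TopologicalSpace X] [PseudoMetricSpace Y]

/-- A family `F(t, ·)` of continuous maps which is Lipschitz in `t` uniformly in `x`
(`dist (F t x) (F s x) ≤ L |t − s|` for `s, t ∈ S`) is jointly continuous on `S × X` (Mathlib's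
`continuousOn_prod_of_continuousOn_lipschitzOnWith`). This is how the time-Lipschitz bounds
(4.8) of KNSS 2009 make `U`, `∇U`, `∇²U` jointly continuous. [folklore] -/
theorem continuousOn_uncurry_of_forall_dist_le {F : ℝ → X → Y} {S : Set ℝ} {L : ℝ}
    (hcont : ∀ t ∈ S, Continuous (F t))
    (hlip : ∀ s ∈ S, ∀ t ∈ S, ∀ x, dist (F t x) (F s x) ≤ L * |t - s|) :
    ContinuousOn (fun p : ℝ × X => F p.1 p.2) (S ×ˢ univ) := by
  refine continuousOn_prod_of_continuousOn_lipschitzOnWith (fun p : ℝ × X => F p.1 p.2)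
    L.toNNReal (fun t ht => (hcont t ht).continuousOn) fun x _ => ?_
  refine LipschitzOnWith.of_dist_le_mul fun t ht s hs => ?_
  calc dist (F t x) (F s x) ≤ L * |t - s| := hlip s hs t ht x
    _ ≤ (L.toNNReal : ℝ) * dist t s := by
        rw [Real.dist_eq]
        exact mul_le_mul_of_nonneg_right (Real.le_coe_toNNReal L) (abs_nonneg _)

end JointContinuity

/-- For a family of smooth slices, a time-Lipschitz bound on the `k`-th derivatives, uniform in
`x` (KNSS 2009, (4.8)), makes `(t, x) ↦ ∇ᵏU(t, x)` jointly continuous on `(−∞, 0) × ℝ³`. [folklore] -/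
theorem continuousOn_iteratedFDeriv_of_lipschitz {U : ℝ → ℝ³ → ℝ³}
    (hs : ∀ t < 0, ContDiff ℝ ∞ (U t)) {k : ℕ} {L : ℝ}
    (hL : ∀ s < 0, ∀ t < 0, ∀ x,
      ‖iteratedFDeriv ℝ k (U t) x - iteratedFDeriv ℝ k (U s) x‖ ≤ L * |t - s|) :
    ContinuousOn (fun p : ℝ × ℝ³ => iteratedFDeriv ℝ k (U p.1) p.2) (Iio 0 ×ˢ univ) :=
  continuousOn_uncurry_of_forall_dist_le (F := fun t x => iteratedFDeriv ℝ k (U t) x)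
    (fun t ht => (hs t ht).continuous_iteratedFDeriv (by exact_mod_cast le_top))
    (fun s hs' t ht x => by rw [dist_eq_norm]; exact hL s hs' t ht x)

/-! ### The swirl is controlled by `r ‖u‖` -/

/-- `|Γ(x)| = |x₀v₁ − x₁v₀| ≤ r ‖v + β e_z‖`: the swirl sees only the horizontal velocity
(Cauchy–Schwarz in the horizontal plane), so the decay `r‖u‖ ≤ C` bounds the swirl of
`u = U + β e_z` and of `U` alike ((5.12) from the hypothesis of Theorem 5.3). [cite: KochNadirashviliSereginSverak2009, proof of Thm 5.3, (5.12) (arXiv p. 10)] -/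
theorem abs_swirl_le_cylRadius_mul_norm_add_smul_eZ (v : ℝ³ → ℝ³) (β : ℝ) (x : ℝ³) :
    |swirl v x| ≤ cylRadius x * ‖v x + β • eZ‖ := by
  have hr : cylRadius x ^ 2 = x 0 ^ 2 + x 1 ^ 2 := cylRadius_sq x
  have hn : ‖v x + β • eZ‖ ^ 2 = v x 0 ^ 2 + v x 1 ^ 2 + (v x 2 + β) ^ 2 := by
    rw [EuclideanSpace.real_norm_sq_eq, Fin.sum_univ_three]
    simp [eZ]
  refine abs_le_of_sq_le_sq ?_ (mul_nonneg (cylRadius_nonneg x) (norm_nonneg _))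
  rw [mul_pow, hr, hn, swirl]
  nlinarith [sq_nonneg (x 0 * v x 0 + x 1 * v x 1), sq_nonneg (v x 2 + β),
    add_nonneg (sq_nonneg (x 0)) (sq_nonneg (x 1))]

/-! ### Theorem 5.3 from the facts -/

/-- **"This means that the solution `u` is swirl-free"** (KNSS 2009, proof of Theorem 5.3, arXiv
p. 10, penultimate sentence): under §4-regularity with the swirl equation
(`KNSS2009_regularity_axisymmetric_swirl`) and the scaling/cut-off argument
(`KNSS2009_swirl_sup_nonpos`), a bounded weak solution of Navier–Stokes in `ℝ³ × (−∞, 0)` which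
is axisymmetric (a.e.) with `r‖u‖ ≤ C` (a.e.) is swirl-free: `swirl (u t) = 0` a.e., for a.e.
`t < 0`. Proof: for the representative `U` with `u = U + β e_z`, the continuous functions
`r‖U + βe_z‖` and `|swirl U| ≤ r‖U + βe_z‖` are `≤ C` a.e., hence everywhere (the tree's
`SereginSverak2009.forall_le_of_ae_le_of_continuousOn`, `SereginSverakBlowupSelection`); `∇ swirl U`
and `Δ swirl U` are jointly continuous by (4.8) and the swirl calculus (`fderiv_swirl_apply`,
`laplacian_swirl`); so `f = swirl U` and the drift `U + β e_z` satisfy the hypotheses of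
`KNSS2009_swirl_sup_nonpos.eq_zero`, `swirl U ≡ 0`, and `swirl u = swirl U` a.e. [cite: KochNadirashviliSereginSverak2009, proof of Thm 5.3 (arXiv p. 10)] -/
theorem KNSS2009_thm53_ae_swirl_free (hreg : KNSS2009_regularity_axisymmetric_swirl)
    (hsup : KNSS2009_swirl_sup_nonpos) {u : ℝ → ℝ³ → ℝ³}
    (hu : IsBoundedWeakNSSolutionOn (Iio 0) isOpen_Iio 1 u)
    (haxi : ∀ θ : ℝ, ∀ᵐ t ∂((volume : Measure ℝ).restrict (Iio 0)),
      (fun x => u t (rotZ θ x)) =ᵐ[volume] fun x => rotZ θ (u t x))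
    (hbound : ∃ C : ℝ, ∀ᵐ t ∂((volume : Measure ℝ).restrict (Iio 0)),
      ∀ᵐ x ∂(volume : Measure ℝ³), cylRadius x * ‖u t x‖ ≤ C) :
    ∀ᵐ t ∂((volume : Measure ℝ).restrict (Iio 0)), swirl (u t) =ᵐ[volume] (0 : ℝ³ → ℝ) := by
  obtain ⟨U, β, hβm, -, hUm, hrep, hsmooth, hdiv, haxiU, -, hlip, hswirlEq⟩ := hreg hu haxi
  obtain ⟨C, hC⟩ := hbound
  set S : Set (ℝ × ℝ³) := Iio 0 ×ˢ univ with hS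
  -- smoothness of the slices in the degrees used below
  have hU2 : ∀ t < 0, ContDiff ℝ 2 (U t) := fun t ht => (hsmooth t ht).of_le (by norm_cast)
  have hU1 : ∀ t < 0, ContDiff ℝ 1 (U t) := fun t ht => (hsmooth t ht).of_le (by norm_cast)
  have hUd : ∀ t < 0, ∀ x, DifferentiableAt ℝ (U t) x := fun t ht x =>
    ((hU1 t ht).differentiable one_ne_zero) x
  -- (4.8) ⇒ joint continuity of `U`, `∇U`, `∇²U`
  have hD : ∀ k : ℕ, ContinuousOn (fun p : ℝ × ℝ³ => iteratedFDeriv ℝ k (U p.1) p.2) S := by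
    intro k
    obtain ⟨L, hL⟩ := hlip k
    exact continuousOn_iteratedFDeriv_of_lipschitz hsmooth hL
  have hUc : ContinuousOn (fun p : ℝ × ℝ³ => U p.1 p.2) S := by
    have h := (ContinuousMultilinearMap.apply ℝ (fun _ : Fin 0 => ℝ³) ℝ³
      (Fin.elim0 : Fin 0 → ℝ³)).continuous.comp_continuousOn (hD 0)
    refine h.congr fun p _ => ?_
    simp only [comp_apply, ContinuousMultilinearMap.apply_apply, iteratedFDeriv_zero_apply]
  have hD1c : ∀ y : ℝ³, ContinuousOn (fun p : ℝ × ℝ³ => fderiv ℝ (U p.1) p.2 y) S := by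
    intro y
    have h := (ContinuousMultilinearMap.apply ℝ (fun _ : Fin 1 => ℝ³) ℝ³
      (fun _ => y)).continuous.comp_continuousOn (hD 1)
    refine h.congr fun p _ => ?_
    simp only [comp_apply, ContinuousMultilinearMap.apply_apply, iteratedFDeriv_one_apply]
  have hD2c : ∀ m : Fin 2 → ℝ³,
      ContinuousOn (fun p : ℝ × ℝ³ => iteratedFDeriv ℝ 2 (U p.1) p.2 m) S := fun m =>
    (ContinuousMultilinearMap.apply ℝ (fun _ : Fin 2 => ℝ³) ℝ³ m).continuous.comp_continuousOn
      (hD 2)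
  -- the decay bound for the representative: a.e. `t`, every `x`
  have hdecayU : ∀ᵐ t ∂((volume : Measure ℝ).restrict (Iio 0)), ∀ x,
      cylRadius x * ‖U t x + β t • eZ‖ ≤ C := by
    filter_upwards [hrep, hC, ae_restrict_mem measurableSet_Iio] with t ht hCt htneg
    have hae : ∀ᵐ x ∂(volume : Measure ℝ³), cylRadius x * ‖U t x + β t • eZ‖ ≤ C := by
      filter_upwards [ht, hCt] with x hx hCx
      rwa [hx] at hCx
    have hcont : Continuous fun x => cylRadius x * ‖U t x + β t • eZ‖ :=
      continuous_cylRadius.mul (((hsmooth t htneg).continuous.add continuous_const).norm)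
    have h := SereginSverak2009.forall_le_of_ae_le_of_continuousOn isOpen_univ hcont.continuousOn
      continuousOn_const (by rwa [Measure.restrict_univ])
    exact fun x => h x (mem_univ x)
  -- the swirl of `U` is bounded by `C` everywhere on `(−∞, 0) × ℝ³`
  have hswirl_bd : ∀ t < 0, ∀ x, |swirl (U t) x| ≤ C := by
    intro t ht x
    have hg : ContinuousOn (fun s => |swirl (U s) x|) (Iio 0) := by
      have h1 : ContinuousOn (fun s : ℝ => U s x) (Iio 0) := by
        have hc : Continuous fun s : ℝ => ((s, x) : ℝ × ℝ³) := by fun_prop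
        exact hUc.comp hc.continuousOn fun s hs => ⟨hs, mem_univ _⟩
      have h2 : ContinuousOn (fun s : ℝ => swirl (U s) x) (Iio 0) := by
        simp only [swirl]
        exact ((continuousOn_const.mul ((PiLp.continuous_apply 2 _ 1).comp_continuousOn h1)).sub
          (continuousOn_const.mul ((PiLp.continuous_apply 2 _ 0).comp_continuousOn h1)))
      exact h2.abs
    refine SereginSverak2009.forall_le_of_ae_le_of_continuousOn (μ := (volume : Measure ℝ))
      isOpen_Iio hg continuousOn_const ?_ t ht
    filter_upwards [hdecayU] with s hs
    exact (abs_swirl_le_cylRadius_mul_norm_add_smul_eZ (U s) (β s) x).trans (hs x)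
  -- `swirl U ≡ 0` by the scaling/cut-off argument applied to `± swirl U`
  have hzero : ∀ t < 0, ∀ x, swirl (U t) x = 0 := by
    refine hsup.eq_zero (f := fun t x => swirl (U t) x) (u := fun t x => U t x + β t • eZ)
      (fun t ht => contDiff_swirl (hsmooth t ht)) ?_ ?_
      (fun t ht => (haxiU t ht).isAxisymmetricScalar_swirl)
      (fun t _ x hx => swirl_eq_zero_of_cylRadius_eq_zero _ hx) ⟨C, hswirl_bd⟩ ?_
      (fun t ht => (hsmooth t ht).add contDiff_const) ?_ ⟨C, hdecayU⟩ hswirlEq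
    · -- `∇Γ` jointly continuous: `DΓ(x)y = ⟪Jx, DU(x)y⟫ + ⟪Jy, U(x)⟫`
      refine continuousOn_clm_apply.2 fun y => ?_
      have hG : ContinuousOn
          (fun p : ℝ × ℝ³ => ⟪rotGen p.2, fderiv ℝ (U p.1) p.2 y⟫ + ⟪rotGen y, U p.1 p.2⟫) S :=
        ((rotGenL.continuous.comp continuous_snd).continuousOn.inner (hD1c y)).add
          (continuousOn_const.inner hUc)
      refine hG.congr fun p hp => ?_
      exact fderiv_swirl_apply (hUd p.1 hp.1 p.2) y
    · -- `ΔΓ` jointly continuous: `ΔΓ = ⟪Jx, ΔU⟫ + 2(∂₀U₁ − ∂₁U₀)`, `ΔU = Σᵢ D²U[eᵢ, eᵢ]`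
      classical
      set b := EuclideanSpace.basisFun (Fin 3) ℝ with hb
      have hΔU : ContinuousOn (fun p : ℝ × ℝ³ => (Δ (U p.1)) p.2) S := by
        have h : ContinuousOn
            (fun p : ℝ × ℝ³ => ∑ i, iteratedFDeriv ℝ 2 (U p.1) p.2 ![b i, b i]) S :=
          continuousOn_finsetSum _ fun i _ => hD2c _
        refine h.congr fun p _ => ?_
        exact congrFun (laplacian_eq_iteratedFDeriv_orthonormalBasis (U p.1) b) p.2
      have hG : ContinuousOn (fun p : ℝ × ℝ³ => ⟪rotGen p.2, (Δ (U p.1)) p.2⟫ +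
          2 * (fderiv ℝ (U p.1) p.2 (EuclideanSpace.single 0 1) 1 -
            fderiv ℝ (U p.1) p.2 (EuclideanSpace.single 1 1) 0)) S :=
        ((rotGenL.continuous.comp continuous_snd).continuousOn.inner hΔU).add
          (continuousOn_const.mul
            (((PiLp.continuous_apply 2 _ 1).comp_continuousOn (hD1c _)).sub
              ((PiLp.continuous_apply 2 _ 0).comp_continuousOn (hD1c _))))
      refine hG.congr fun p hp => ?_
      exact laplacian_swirl (hU2 p.1 hp.1) p.2
    · -- the drift is jointly measurable
      show Measurable fun p : ℝ × ℝ³ => U p.1 p.2 + β p.1 • eZ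
      exact hUm.add ((hβm.comp measurable_fst).smul_const eZ)
    · -- the drift is divergence free (a constant has zero derivative)
      intro t ht x
      have hfd : fderiv ℝ (fun y => U t y + β t • eZ) x = fderiv ℝ (U t) x := fderiv_add_const _
      simp only [VectorCalculus.divergence, hfd]
      exact hdiv t ht x
  -- transfer to `u = U + β e_z` (a.e.)
  filter_upwards [hrep, ae_restrict_mem measurableSet_Iio] with t ht htneg
  filter_upwards [ht] with x hx
  have h0 := hzero t htneg x
  simp only [swirl] at h0
  simp only [swirl, hx, Pi.zero_apply, PiLp.add_apply, PiLp.smul_apply, eZ,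
    PiLp.single_apply, smul_eq_mul]
  simp only [Fin.isValue, show (1 : Fin 3) ≠ 2 by decide, show (0 : Fin 3) ≠ 2 by decide,
    if_false, mul_zero, add_zero]
  exact h0

/-- **KNSS 2009, Theorem 5.3 from the named facts.** Theorem 5.3 as printed
(`KNSS2009_liouville_bound_C_over_r`) follows from (1) §4-regularity with the swirl equation
(5.10) for the axisymmetric representative (`KNSS2009_regularity_axisymmetric_swirl`), (2) the
scaling/cut-off argument of p. 10 (`KNSS2009_swirl_sup_nonpos`, into which Lemma 2.1,
`KNSS2009_lemma21`, enters) and (3) Theorem 5.2 (`KNSS2009_liouville_axisymmetric_no_swirl`):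
by (1)–(2) the solution is swirl-free (`KNSS2009_thm53_ae_swirl_free`), and "we can apply
Theorem 5.2 to conclude that `u = 0`" (`KNSS2009_liouville_axisymmetric_no_swirl.ae_eq_zero_of_bound`,
proved in `KNSSLiouville`). [cite: KochNadirashviliSereginSverak2009, Thm 5.3 and its proof (arXiv p. 10)] -/
theorem KNSS2009_liouville_bound_C_over_r_of_facts (hreg : KNSS2009_regularity_axisymmetric_swirl)
    (hsup : KNSS2009_swirl_sup_nonpos) (h52 : KNSS2009_liouville_axisymmetric_no_swirl) :
    KNSS2009_liouville_bound_C_over_r := fun _u hu haxi hbound =>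
  KNSS2009_liouville_axisymmetric_no_swirl.ae_eq_zero_of_bound h52 hu haxi
    (KNSS2009_thm53_ae_swirl_free hreg hsup hu haxi hbound) hbound

end R3

end Literature.Analysis.FluidPDE

end
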